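import Mathlib
import Summits.KontsevichZagierPeriods.Zeta5Search.TypeSpaceAggregateOrigin
import HarnessLib

/-!
# ζ(5) search — the type-space law, ORIGIN regime: transport of the orbit points through a hit deep orbit

HONEST FRAMING: systematic search; no irrationality claim unless certified.

Cell `pub-zeta5`, prover seat p3 (gen 2).  The missing ingredient for the tree statement `ResidueLaw.TypeSpaceLawOrigin` (REPORT-gen2-g11 §4,
THEOREM W (O)): in the ORIGIN regime the deep type lists are NOT palindromic, so the zero-regime transport `point_transfer` (which goes through
the palindromic raise-pair lemma `typeW/V_raise_pair`) is not available.  The GENERAL raise lemmas `typeW_raiseAt` / `typeV_raiseAt`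
(`σ(f + δ_ℓ) = σ₂(f) − ℓ·σ(f)`, no palindromicity) give instead, for a level function `f` on `0..L`, its reverse `f^rev` and `ℓ₀ ≤ L`,

  `2(σ(f+δ_{ℓ₀}) + σ((f+δ_{ℓ₀})^rev)) − (τ(f) + τ(f^rev)) = (L − 2ℓ₀)·(σ(f) − σ(f^rev))`   (`raise_pair_W`, `raise_pair_V`),

i.e. when the moved point of `b ↦ b + e_j` hits a deep orbit `{z, z̄}` (types `f`, `f^rev`, raised at the levels `ℓ₀`, `L − ℓ₀`), the new doubled
sub-deep point differs from the old deep point `τ_z + τ_z̄` by `(L − 2ℓ₀)` times the EXACT first-order orbit vector `σ_z − σ_z̄`, which in the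
origin regime is parallel to `u`.  Hence `det(u, P_y − P_x)` transports exactly from `b` to `b + e_j` (`dirDet_shift`), and the parallelism
hypothesis of `TypeSpaceLawOrigin` for `b` implies the one for `b + e_j` (`HD_shift`).  (The zero regime is the case `σ_z = σ_z̄`.)
`p`-adic bookkeeping of rational numbers; nothing here bears on irrationality.
-/

noncomputable section

open Finset

namespace Summit.KontsevichZagierPeriods.Zeta5Search.SecondOrder

open Summit.KontsevichZagierPeriods.Zeta5Search.DualSeries (InBox)
open Summit.KontsevichZagierPeriods.Zeta5Search.CasoratianValuation (InPolytope shift)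
open Summit.KontsevichZagierPeriods.Zeta5Search.ClusterValuation
open Summit.KontsevichZagierPeriods.Zeta5Search.PadicSeries
open Summit.KontsevichZagierPeriods.Zeta5Search.BigPrime (shift_zero)
open Summit.KontsevichZagierPeriods.Zeta5Search.LevelClass (typeW typeV typeW_congr typeV_congr)
open Summit.KontsevichZagierPeriods.Zeta5Search.CellKit (conj_level netExp_conj_level two_mul_le_of_shift classExp_shift_eq)
open Summit.KontsevichZagierPeriods.Zeta5Search.ResidueLaw (pointW pointV liveClasses dirDet)

variable {p : ℕ} [hp : Fact p.Prime]

/-! ## §1 The general raise pair -/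

omit hp in
/-- Reflecting a raise: on the levels `k ≤ L`, `(f + δ_{ℓ₀})(L − k) = (f^rev + δ_{L−ℓ₀})(k)`. -/
theorem raiseAt_reflect (f : ℕ → ℤ) {L ℓ₀ : ℕ} (hℓ₀ : ℓ₀ ≤ L) :
    ∀ k ≤ L, raiseAt f ℓ₀ (L - k) = raiseAt (fun i => f (L - i)) (L - ℓ₀) k := by
  intro k hk
  unfold raiseAt
  by_cases h : L - k = ℓ₀
  · rw [if_pos h, if_pos (by omega)]
  · rw [if_neg h, if_neg (by omega)]

omit hp in
/-- **General raise pair, `W`**: for ANY level function `f` on `0..L` and `ℓ₀ ≤ L`,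
`2(ŵ(f+δ_{ℓ₀}) + ŵ((f+δ_{ℓ₀})^rev)) − (τ_W(f) + τ_W(f^rev)) = (L − 2ℓ₀)(ŵ(f) − ŵ(f^rev))`. -/
theorem raise_pair_W (f : ℕ → ℤ) {L ℓ₀ : ℕ} (hℓ₀ : ℓ₀ ≤ L) :
    2 * (typeW L (raiseAt f ℓ₀) + typeW L (fun k => raiseAt f ℓ₀ (L - k)))
        - (typeTauW L f + typeTauW L (fun k => f (L - k)))
      = ((L : ℚ) - 2 * (ℓ₀ : ℚ)) * (typeW L f - typeW L (fun k => f (L - k))) := by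
  rw [typeW_congr (raiseAt_reflect f hℓ₀), typeW_raiseAt f hℓ₀, typeW_raiseAt (fun i => f (L - i)) (Nat.sub_le L ℓ₀)]
  unfold typeTauW
  push_cast [Nat.cast_sub hℓ₀]
  ring

omit hp in
/-- **General raise pair, `V`**: `2(v̂(f+δ_{ℓ₀}) + v̂((f+δ_{ℓ₀})^rev)) − (τ_V(f) + τ_V(f^rev)) = (L − 2ℓ₀)(v̂(f) − v̂(f^rev))`. -/
theorem raise_pair_V (f : ℕ → ℤ) {L ℓ₀ : ℕ} (hℓ₀ : ℓ₀ ≤ L) :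
    2 * (typeV L (raiseAt f ℓ₀) + typeV L (fun k => raiseAt f ℓ₀ (L - k)))
        - (typeTauV L f + typeTauV L (fun k => f (L - k)))
      = ((L : ℚ) - 2 * (ℓ₀ : ℚ)) * (typeV L f - typeV L (fun k => f (L - k))) := by
  rw [typeV_congr (raiseAt_reflect f hℓ₀), typeV_raiseAt f hℓ₀, typeV_raiseAt (fun i => f (L - i)) (Nat.sub_le L ℓ₀)]
  unfold typeTauV
  push_cast [Nat.cast_sub hℓ₀]
  ring

/-! ## §2 Transport through a hit deep orbit -/

section Transfer

variable (b : ℕ → ℤ) {j : ℕ} (hb : InPolytope b) (hb' : InPolytope (shift b j)) (hj1 : 1 ≤ j) (hj7 : j ≤ 7)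
  (hpn : (p : ℤ) ≤ b 0) {M : ℕ} (u : ℤ × ℤ)
  (G1 : ∀ x, x < p → 1 ≤ classPoleCount b p x → -(M : ℤ) ≤ classExp b p x)
  (G3o : ∀ x, x < p → 1 ≤ classPoleCount b p x → classExp b p x = -(M : ℤ) →
    ¬ CentreIn b p x ∧
    (u.1 : ℚ) * (vHat b p x - vHat b p (conjClass b p x)) - (u.2 : ℚ) * (wHat b p x - wHat b p (conjClass b p x)) = 0)
include hb hb' hj1 hj7 hpn G1 G3o

omit G1 G3o in
/-- **Level data of a hit class**: if the class of `y` gains exactly one unit of exponent under `b ↦ b + e_j`, its new level exponents are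
the old ones raised at ONE level `ℓ₀ ≤ L` (the levels themselves do not move: `b₀` is unchanged). -/
theorem raiseAt_of_hit {y : ℕ} (hy : y < p) (hone : classExp (shift b j) p y = classExp b p y + 1) :
    ∃ ℓ₀ ≤ topLevel b p y, ∀ ℓ ≤ topLevel b p y,
      netExp (shift b j) (y + ℓ * p) = raiseAt (fun k => netExp b (y + k * p)) ℓ₀ ℓ := by
  have hp0 : 0 < p := hp.out.pos
  have hyn : y ≤ (b 0).toNat := le_b0_of_lt b hpn hy
  have h2 := two_mul_le_of_shift b hj1 hj7 hb'
  have hsum := classExp_shift_eq b hb hj1 hj7 hb' p y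
  have hone' : ∑ s ∈ classSet b p y,
      (if s = (b j).toNat ∨ s = (b 0).toNat - (b j).toNat then (1 : ℤ) else 0) = 1 := by omega
  rw [sum_boole] at hone'
  have hcard : ((classSet b p y).filter fun s => s = (b j).toNat ∨ s = (b 0).toNat - (b j).toNat).card = 1 := by
    exact_mod_cast hone'
  obtain ⟨s₀, hs₀⟩ := card_eq_one.1 hcard
  have hs₀mem : s₀ ∈ (classSet b p y).filter fun s => s = (b j).toNat ∨ s = (b 0).toNat - (b j).toNat := by
    rw [hs₀]; exact mem_singleton_self _
  obtain ⟨hs₀c, hs₀mv⟩ := mem_filter.1 hs₀mem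
  obtain ⟨hL, hL'⟩ := level_bounds' (p := p) b hyn
  set L := topLevel b p y with hLdef
  rw [LevelClass.classSet_level b hy hL hL'] at hs₀c
  obtain ⟨ℓ₀, hℓ₀, rfl⟩ := mem_image.1 hs₀c
  refine ⟨ℓ₀, by have := mem_range.1 hℓ₀; omega, fun ℓ hℓ => ?_⟩
  rw [CellA.netExp_shift_eq b hb.1 hj1 hj7 h2, raiseAt]
  have hmem : y + ℓ * p ∈ classSet b p y := LevelClass.level_mem b hy hL hL' hℓ
  by_cases hℓℓ : ℓ = ℓ₀
  · subst hℓℓ; rw [if_pos hs₀mv, if_pos rfl]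
  · have hnot : ¬ (y + ℓ * p = (b j).toNat ∨ y + ℓ * p = (b 0).toNat - (b j).toNat) := by
      intro h
      have : y + ℓ * p ∈ (classSet b p y).filter fun s => s = (b j).toNat ∨ s = (b 0).toNat - (b j).toNat :=
        mem_filter.2 ⟨hmem, h⟩
      rw [hs₀, mem_singleton] at this
      exact hℓℓ (LevelClass.level_injective hp0 y this)
    rw [if_neg hnot, if_neg hℓℓ, add_zero]

/-- **Orbit points transport up to the exact orbit vector (origin regime).**  A live class `z` of `b + e_j` is a live class of `b`, and its
doubled orbit point moves by a rational multiple `λ` of the exact first-order orbit vector `σ_z − σ_z̄` of `b`: `λ = L − 2ℓ₀` for a hit deep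
class raised at the level `ℓ₀`, `λ = 0` otherwise. -/
theorem point_transfer_origin {z : ℕ} (hz : z ∈ liveClasses (shift b j) p M) :
    z ∈ liveClasses b p M ∧ ∃ lam : ℚ,
      pointW (shift b j) p M z = pointW b p M z + lam * (wHat b p z - wHat b p (conjClass b p z)) ∧
      pointV (shift b j) p M z = pointV b p M z + lam * (vHat b p z - vHat b p (conjClass b p z)) ∧
      (lam = 0 ∨ (1 ≤ classPoleCount b p z ∧ classExp b p z = -(M : ℤ))) := by
  have h0 : 0 ≤ b 0 := hb.1.1
  have h0' : 0 ≤ shift b j 0 := by rw [shift_zero b hj1]; exact h0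
  obtain ⟨hzr, h1, hE⟩ := mem_filter.1 hz
  have hzp := mem_range.1 hzr
  have hzn : z ≤ (b 0).toNat := le_b0_of_lt b hpn hzp
  have hzn' : z ≤ (shift b j 0).toNat := by rw [shift_zero b hj1]; exact hzn
  have h1b : 1 ≤ classPoleCount b p z := le_trans h1 (classPoleCount_shift_le b hb.1 hj1 p z)
  have hEb := G1 z hzp h1b
  have hge := classExp_shift_ge b hb.1 hj1 p z
  have hcs : conjClass (shift b j) p z = conjClass b p z := by unfold conjClass; rw [shift_zero b hj1]
  have heqc : classExp (shift b j) p z = classExp b p z →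
      classExp (shift b j) p (conjClass b p z) = classExp b p (conjClass b p z) := fun heq => by
    rw [← hcs, classExp_conj (shift b j) h0' hzn', hcs, classExp_conj b h0 hzn, heq]
  rcases hE with hE | hE
  · -- deep in `b + e_j`: an unhit deep class of `b`, same point
    have heq : classExp (shift b j) p z = classExp b p z := by omega
    have hEbm : classExp b p z = -(M : ℤ) := by omega
    refine ⟨mem_filter.2 ⟨hzr, h1b, Or.inl hEbm⟩, 0, ?_, ?_, Or.inl rfl⟩
    · unfold pointW
      rw [if_pos hE, if_pos hEbm, hcs, tauW_shift_of_classExp_eq b hb.1 hj1 heq,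
        tauW_shift_of_classExp_eq b hb.1 hj1 (heqc heq)]
      ring
    · unfold pointV
      rw [if_pos hE, if_pos hEbm, hcs, tauV_shift_of_classExp_eq b hb.1 hj1 heq,
        tauV_shift_of_classExp_eq b hb.1 hj1 (heqc heq)]
      ring
  · by_cases heq : classExp (shift b j) p z = classExp b p z
    · -- an unhit sub-deep class, same point
      have hEbm : classExp b p z = -(M : ℤ) + 1 := by omega
      have hne : classExp b p z ≠ -(M : ℤ) := by omega
      have hne' : classExp (shift b j) p z ≠ -(M : ℤ) := by omega
      refine ⟨mem_filter.2 ⟨hzr, h1b, Or.inr hEbm⟩, 0, ?_, ?_, Or.inl rfl⟩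
      · unfold pointW
        rw [if_neg hne', if_neg hne, wHat_shift_of_classExp_eq b hb.1 hj1 heq,
          orbitW_shift_of_classExp_eq b hb.1 hj1 heq (heqc heq)]
        simp only [centreIn_shift b hj1]
        ring
      · unfold pointV
        rw [if_neg hne', if_neg hne, vHat_shift_of_classExp_eq b hb.1 hj1 heq,
          orbitV_shift_of_classExp_eq b hb.1 hj1 heq (heqc heq)]
        simp only [centreIn_shift b hj1]
        ring
    · -- hit: a deep class of `b`; its new level exponents are a single interior raise of the old ones
      have hEbm : classExp b p z = -(M : ℤ) := by omega
      obtain ⟨hc, -⟩ := G3o z hzp h1b hEbm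
      obtain ⟨ℓ₀, hℓ₀, hnew⟩ := raiseAt_of_hit b hb hb' hj1 hj7 hpn hzp (by omega)
      obtain ⟨hL, hL'⟩ := level_bounds' (p := p) b hzn
      set L := topLevel b p z with hLdef
      set f : ℕ → ℤ := fun k => netExp b (z + k * p) with hfdef
      have hf : ∀ k ≤ L, netExp b (z + k * p) = f k := fun k _ => rfl
      have hnew' : ∀ k ≤ L, netExp (shift b j) (z + k * p) = raiseAt f ℓ₀ k := hnew
      -- the conjugate class: levels `0..L`, exponents reversed (in `b` and in `b + e_j`)
      obtain ⟨hz', hM2, hM2'⟩ := conj_level b hzp hL hL'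
      have hfc : ∀ k ≤ L, netExp b (conjClass b p z + k * p) = f (L - k) := fun k hk => netExp_conj_level b hL hL' h0 hk
      have hLs : z + L * p ≤ (shift b j 0).toNat := by rw [shift_zero b hj1]; exact hL
      have hLs' : (shift b j 0).toNat < z + L * p + p := by rw [shift_zero b hj1]; exact hL'
      have hz's : conjClass (shift b j) p z < p := by rw [hcs]; exact hz'
      have hM2s : conjClass (shift b j) p z + L * p ≤ (shift b j 0).toNat := by rw [hcs, shift_zero b hj1]; exact hM2
      have hM2s' : (shift b j 0).toNat < conjClass (shift b j) p z + L * p + p := by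
        rw [hcs, shift_zero b hj1]; exact hM2'
      have hfcs : ∀ k ≤ L, netExp (shift b j) (conjClass (shift b j) p z + k * p) = raiseAt f ℓ₀ (L - k) := by
        intro k hk
        rw [netExp_conj_level (shift b j) hLs hLs' h0' hk]
        exact hnew' (L - k) (Nat.sub_le L k)
      -- no centre anywhere
      have hc0 : ¬ (¬ (2 : ℤ) ∣ b 0 ∧ CentreIn b p z) := fun h => hc h.2
      have hcc : ¬ CentreIn b p (conjClass b p z) := fun h => hc ((centreIn_conj_iff b h0 hzn).1 h)
      have hc0c : ¬ (¬ (2 : ℤ) ∣ b 0 ∧ CentreIn b p (conjClass b p z)) := fun h => hcc h.2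
      have hc' : ¬ CentreIn (shift b j) p z := fun h => hc ((centreIn_shift b hj1 p z).1 h)
      have hc0s : ¬ (¬ (2 : ℤ) ∣ shift b j 0 ∧ CentreIn (shift b j) p z) := fun h => hc' h.2
      have hc0cs : ¬ (¬ (2 : ℤ) ∣ shift b j 0 ∧ CentreIn (shift b j) p (conjClass (shift b j) p z)) := by
        rintro ⟨-, h⟩
        rw [hcs, centreIn_shift b hj1] at h
        exact hcc h
      -- all values through the type functionals
      have hw : wHat b p z = typeW L f := wHat_level₀ b hzp hL hL' f hf hc0
      have hv : vHat b p z = typeV L f := vHat_level₀ b hzp hL hL' f hf hc0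
      have hwc : wHat b p (conjClass b p z) = typeW L (fun k => f (L - k)) := wHat_level₀ b hz' hM2 hM2' _ hfc hc0c
      have hvc : vHat b p (conjClass b p z) = typeV L (fun k => f (L - k)) := vHat_level₀ b hz' hM2 hM2' _ hfc hc0c
      have htw : tauW b p z = typeTauW L f := tauW_level₀ b hzp hL hL' f hf hc0
      have htv : tauV b p z = typeTauV L f := tauV_level₀ b hzp hL hL' f hf hc0
      have htwc : tauW b p (conjClass b p z) = typeTauW L (fun k => f (L - k)) := tauW_level₀ b hz' hM2 hM2' _ hfc hc0c
      have htvc : tauV b p (conjClass b p z) = typeTauV L (fun k => f (L - k)) := tauV_level₀ b hz' hM2 hM2' _ hfc hc0c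
      have hw' : wHat (shift b j) p z = typeW L (raiseAt f ℓ₀) := wHat_level₀ (shift b j) hzp hLs hLs' _ hnew' hc0s
      have hv' : vHat (shift b j) p z = typeV L (raiseAt f ℓ₀) := vHat_level₀ (shift b j) hzp hLs hLs' _ hnew' hc0s
      have hwc' : wHat (shift b j) p (conjClass (shift b j) p z) = typeW L (fun k => raiseAt f ℓ₀ (L - k)) :=
        wHat_level₀ (shift b j) hz's hM2s hM2s' _ hfcs hc0cs
      have hvc' : vHat (shift b j) p (conjClass (shift b j) p z) = typeV L (fun k => raiseAt f ℓ₀ (L - k)) :=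
        vHat_level₀ (shift b j) hz's hM2s hM2s' _ hfcs hc0cs
      have hne' : classExp (shift b j) p z ≠ -(M : ℤ) := by omega
      have hPW' : pointW (shift b j) p M z = 2 * (wHat (shift b j) p z + wHat (shift b j) p (conjClass (shift b j) p z)) := by
        unfold pointW orbitW; rw [if_neg hne', if_neg hc', if_neg hc']; rfl
      have hPV' : pointV (shift b j) p M z = 2 * (vHat (shift b j) p z + vHat (shift b j) p (conjClass (shift b j) p z)) := by
        unfold pointV orbitV; rw [if_neg hne', if_neg hc', if_neg hc']; rfl
      have hPW : pointW b p M z = tauW b p z + tauW b p (conjClass b p z) := by unfold pointW; rw [if_pos hEbm]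
      have hPV : pointV b p M z = tauV b p z + tauV b p (conjClass b p z) := by unfold pointV; rw [if_pos hEbm]
      have eW := raise_pair_W f hℓ₀
      have eV := raise_pair_V f hℓ₀
      refine ⟨mem_filter.2 ⟨hzr, h1b, Or.inl hEbm⟩, (L : ℚ) - 2 * (ℓ₀ : ℚ), ?_, ?_, Or.inr ⟨h1b, hEbm⟩⟩
      · rw [hPW', hPW, hw', hwc', htw, htwc, hw, hwc]
        linear_combination eW
      · rw [hPV', hPV, hv', hvc', htv, htvc, hv, hvc]
        linear_combination eV

/-- **`det(u, P_y − P_x)` transports exactly** from `b` to `b + e_j` on the live classes of `b + e_j`. -/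
theorem dirDet_shift {x y : ℕ} (hx : x ∈ liveClasses (shift b j) p M) (hy : y ∈ liveClasses (shift b j) p M) :
    dirDet (shift b j) p M u x y = dirDet b p M u x y := by
  obtain ⟨hxb, lx, hxW, hxV, hlx⟩ := point_transfer_origin b hb hb' hj1 hj7 hpn u G1 G3o hx
  obtain ⟨hyb, ly, hyW, hyV, hly⟩ := point_transfer_origin b hb hb' hj1 hj7 hpn u G1 G3o hy
  have kx : lx * ((u.1 : ℚ) * (vHat b p x - vHat b p (conjClass b p x))
      - (u.2 : ℚ) * (wHat b p x - wHat b p (conjClass b p x))) = 0 := by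
    rcases hlx with h | ⟨h1x, hEx⟩
    · rw [h, zero_mul]
    · rw [(G3o x (mem_range.1 (mem_filter.1 hxb).1) h1x hEx).2, mul_zero]
  have ky : ly * ((u.1 : ℚ) * (vHat b p y - vHat b p (conjClass b p y))
      - (u.2 : ℚ) * (wHat b p y - wHat b p (conjClass b p y))) = 0 := by
    rcases hly with h | ⟨h1y, hEy⟩
    · rw [h, zero_mul]
    · rw [(G3o y (mem_range.1 (mem_filter.1 hyb).1) h1y hEy).2, mul_zero]
  unfold dirDet
  rw [hxW, hxV, hyW, hyV]
  linear_combination ky - kx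

/-- **The parallelism hypothesis of `TypeSpaceLawOrigin` transports to `b + e_j`.** -/
theorem HD_shift
    (HD : ∀ x ∈ liveClasses b p M, ∀ y ∈ liveClasses b p M, dirDet b p M u x y = 0 ∨ 1 ≤ padicValRat p (dirDet b p M u x y)) :
    ∀ x ∈ liveClasses (shift b j) p M, ∀ y ∈ liveClasses (shift b j) p M,
      dirDet (shift b j) p M u x y = 0 ∨ 1 ≤ padicValRat p (dirDet (shift b j) p M u x y) := by
  intro x hx y hy
  rw [dirDet_shift b hb hb' hj1 hj7 hpn u G1 G3o hx hy]
  exact HD x (point_transfer_origin b hb hb' hj1 hj7 hpn u G1 G3o hx).1 y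
    (point_transfer_origin b hb hb' hj1 hj7 hpn u G1 G3o hy).1

end Transfer

end Summit.KontsevichZagierPeriods.Zeta5Search.SecondOrder

end
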